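import Summits.QuantumFields.BalabanUV.T4Continuum.Spine.NE1p.DressedOutputAnalyticFaces
import Summits.QuantumFields.BalabanUV.T4Continuum.Spine.NE1p.DressedSmallFieldTorusWitness

/-!
# T⁴ programme, spine estimate NE1′ (node O3b/H2) — THE RESPONSE AND JOINT-ANALYTICITY TORUS FACES FIRE, WITH THE SOURCE
# DERIVATIVE OF THE TOY OUTPUT IN CLOSED FORM (crew WITNESS row, PART 1 of 2; decided toys on pv22's constructed carrier)

Cell `pub-balaban`, sub-cell `t4`, BINDER-OWNERS row NE1′ (owner lineage t4-ne1p-p1); NE1′ formalisation crew seat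
`b2b-balaban-t4-ne1p-formalise-leaf-06` (LEAF PROVER 06, generation 9); crew WITNESS row «THE RESPONSE, (2.14)-SHAPE AND
JOINT-ANALYTICITY TORUS FACES FIRE» (INTENT `CLAIMS.log` 2026-08-20T16:21:27Z; first refusals W24 ∕ S25 author lineages «GO»).
ADDITIVE — imports S25 `Spine/NE1p/DressedOutputAnalyticFaces` (p222529; ⇒ S24 `DressedSmallFieldGeometryFaces`, N0n, N0o, N0j–N0l,
pv22) and W24 `Spine/NE1p/DressedSmallFieldTorusWitness` (v1.1 p224686) ONLY; toy constants only (0 `def` in this part), 0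
`def … : Prop`, 0 cite, 0 sorry; nothing of S24 ∕ S25 ∕ W24 ∕ N0j–N0o is restated — their declarations are used BY NAME.

WHY THIS FILE.  Seven crew torus ENDs had NO applier anywhere in `T4Continuum/`: S24 §2 `regenPart_locE_le_torus` ((w5) regeneration
with decay), `muDeriv_locE_le_torus` (LINEAR RESPONSE in the source — the face the (w6) allowance arithmetic consumes),
`muPart_locE_le_of_rep_torus` (N0k's (2.14)-SHAPE END), `muPart_locE_le_of_births_torus` (N0l's BIRTHS END), and S25 §2
`differentiableOn_locE_param_torus`, `analytic_and_bounded_locE_param_torus`, `differentiableOn_locE_source_background_torus` (N0n's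
three ENDs).  On the carrier `tsys 4 N` only N0o's faces (W24 §2∕§2b), S26's print-clause face (W24 v1.1) and N0p §3's ENDs (W31) had
fired; the bare N0j∕N0k∕N0l∕N0n ENDs fire on W23's ABSTRACT two-cube catalogue (W23∕W25∕W26∕W27∕W29).  THIS PART fires FIVE of
the seven ONCE each BY NAME on W24's decided one-cube datum (`X₀ N`, pencil `act N c`, sockets `hhol_torus`∕`hm_torus`∕`hL3_torus`,
clause instance `A⋆ := (e·K₀(64,8)·9·64)⁻¹`), and computes the response face's OBJECT in CLOSED FORM; PART 2
(`DressedRepresentationTorusWitness`) fires the (2.14)-SHAPE and BIRTHS faces on a two-atom exponential pencil.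
* §0 `hsmall_num` — S24 §2's located clause `A·e^{5·0+1}·K₀(64,8)·9·64 ≤ 1` for every toy constant `A ≤ A⋆`; `envelope_closed` —
  the (2.41) envelope at the located constants is `K₀(64,8)`.
* §1 `regen_fires_torus` (S24 `regenPart_locE_le_torus`, strength pencil `ϱ := 2`, slope `A⋆∕2`; closed form `K₀(64,8)`) and
  `muDeriv_fires_torus` (S24 `muDeriv_locE_le_torus`, slope `A⋆∕μ₁`; closed form `2·K₀(64,8)∕(μ₁ − μ₀)`).
* §2 THE EXACT RESPONSE: `hasDerivAt_locE_cube` — for `0 < c`, `ρ·c ≤ A⋆`, `‖μ‖ < ρ`: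
  `HasDerivAt (s ↦ E_{act c s}({0})) (c∕(1 + μ·c)) μ` (S24 `differentiableOn_locE_torus` for differentiability, W24 `exp_locE_cube`
  for `exp ∘ E = 1 + s·c` on the disc, `HasDerivAt.cexp` + uniqueness); `deriv_locE_cube_ne_zero` (GENUINE: the response is not
  zero); `norm_deriv_locE_cube_le` — at the face's slope the EXACT response is `≤ A⋆∕(μ₁ − μ₀)` against the face's `2·K₀(64,8)∕(μ₁ − μ₀)`:
  the room of the response face on the datum is DISPLAYED (`A⋆ : 2K₀`), not hidden.
* §3 S25's three ENDs ONCE each on the BACKGROUND-MODULATED pencil `p ↦ act N (A⋆∕μ₁) (p.1·p.2)` on `ball 0 μ₁ ×ˢ ball 0 1`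
  (`B := ℂ`; W26's pattern transplanted to the carrier): `jointFace_fires_torus`, `paramFace_fires_torus`, `pairFace_fires_torus`
  (bound half in closed form `K₀(64,8)`); GENUINE: `eq_of_locE_cube_eq` (the toy output SEPARATES sources), whence the joint output
  MOVES with the background (`jointOutput_moves_with_background_torus`) and with the source (`jointOutput_moves_with_source_torus`).

HONEST FRAMING.  A WITNESS over hypothesis SHAPES: five crew torus FACES applied once each BY NAME on W24's decided one-cube datum on
pv22's CONSTRUCTED carrier, and the source derivative of the TOY's `locE` in closed form — typer R-T113 (iii-c) rider, verbatim: «`c∕(1 + μc)`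
is the derivative of the toy's `log(1 + s·c)` on W24's one-cube datum — OUR closed form on a decided toy, not Bałaban's response ∕ source
derivative of print; the faces' numerals are pv22's PROVED constants BY NAME» (v1.1, DOC-ONLY: this sentence added after cross-read X130;
every declaration byte-identical to v1 p226544); every (B3) `hL3` is toy-true BY CHOICE of the
toy constant ((B3) = GAPS G-ne9p2-5, UNPRINTED — untouched); (B1)∕(E1)∕(E2) are inhabited by a decided linear pencil, NOT by Bałaban's
(2.14) activities; (B5)'s clauses are met at pv22's numerals by W24's equality instance; 0 binders instantiated on Bałaban's densities ∕
minimisers ∕ backgrounds; discharges no wall item; the wall line v1.6 does NOT move; R-t4r2-Q2 NOT met thereby; NE1′ ⇐ the named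
binders — NOT printed, NOT proved; spine PROVED 0∕9; count 9 unchanged.  Printed loci ([Balaban1988RGII] (2.14) p. 15, (2.38) p. 20,
(2.41) p. 21; [Balaban1987RGI] (1.18) p. 249) are TYPE ∕ CONTEXT through the imported [cite]-tagged Literature modules, re-asserted
nowhere; ABSOLUTE RULE honoured ([folklore] kernel lemmas only).  Rung (B)+1 on ONE finite four-torus — NOT infinite volume, NOT a
mass gap, NOT OS on ℝ⁴, NOT Clay.  HONEST DEPENDENCY: continuum YM on T⁴ ⇐ BetaPertH ∧ nine spine estimates (0/9 proved); BetaPertH ⇐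
(D1) ∧ (D4) ∧ CAP+tail; G-an2-4 gates asym, D1 and NE2/3/4.
-/

noncomputable section

namespace Summit.QuantumFields.BalabanUV.T4Continuum.NE1p.DressedResponseTorusWitness

open Metric Set Complex MeasureTheory
open Literature.MathematicalPhysics.QuantumFieldTheory.Balaban1983to89.B12TreeDecay (K₀ K₀_pos)
open Literature.MathematicalPhysics.QuantumFieldTheory.Balaban1983to89.B13Resummation (locE)
open Literature.MathematicalPhysics.QuantumFieldTheory.Balaban1983to89.TreeLengthTorus (TPt TDom tsys torusTreeLen)
open Literature.MathematicalPhysics.QuantumFieldTheory.Balaban1983to89.TreeLengthTorusGeometry (TTouch)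
open Summit.QuantumFields.BalabanUV.T4Continuum.NE1p.DressedSmallFieldGeometryFaces (regenPart_locE_le_torus muDeriv_locE_le_torus
  differentiableOn_locE_torus)
open Summit.QuantumFields.BalabanUV.T4Continuum.NE1p.DressedOutputAnalyticFaces (differentiableOn_locE_param_torus
  analytic_and_bounded_locE_param_torus differentiableOn_locE_source_background_torus)
open Summit.QuantumFields.BalabanUV.T4Continuum.NE1p.DressedSmallFieldTorusWitness (X₀ X₀_val act act_X₀ hhol_torus hm_torus
  hL3_torus prefactor_pos hrate_torus_num dressedConst_le_one exp_locE_cube)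

variable (N : ℕ) [NeZero N]

/-! ## §0 The located clause in S24's numerals for any toy constant `A ≤ A⋆ := (e·K₀(64,8)·9·64)⁻¹` -/

/-- The «ε small» clause of S24 §2 at `r₁ = 0` for every nonnegative toy constant `A ≤ A⋆ = (e·K₀(64,8)·9·64)⁻¹`. [folklore] -/
theorem hsmall_num {A : ℝ} (hA : A ≤ (Real.exp 1 * K₀ 64 8 * 9 * 64)⁻¹) :
    A * Real.exp (5 * 0 + 1) * K₀ 64 8 * 9 * 64 ≤ 1 := by
  rw [mul_zero, zero_add]
  have hP := prefactor_pos
  calc A * Real.exp 1 * K₀ 64 8 * 9 * 64 = A * (Real.exp 1 * K₀ 64 8 * 9 * 64) := by ring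
    _ ≤ (Real.exp 1 * K₀ 64 8 * 9 * 64)⁻¹ * (Real.exp 1 * K₀ 64 8 * 9 * 64) := by gcongr
    _ = 1 := inv_mul_cancel₀ hP.ne'

/-- `A⋆ = (e·K₀(64,8)·9·64)⁻¹` is positive. [folklore] -/
theorem Astar_pos : 0 < (Real.exp 1 * K₀ 64 8 * 9 * 64)⁻¹ := inv_pos.2 prefactor_pos

/-- CLOSED FORM of the (2.41) envelope at the located constants: `e·9·64·K₀²·A⋆·e⁰ = K₀(64,8)`. [folklore] -/
theorem envelope_closed : Real.exp 1 * 9 * 64 * K₀ 64 8 ^ 2 * (Real.exp 1 * K₀ 64 8 * 9 * 64)⁻¹ *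
    Real.exp (-(0 * torusTreeLen (X₀ N).1)) = K₀ 64 8 := by
  rw [zero_mul, neg_zero, Real.exp_zero, mul_one]
  have hK : K₀ (64 : ℝ) 8 ≠ 0 := (K₀_pos _ _).ne'
  have he : Real.exp 1 ≠ 0 := (Real.exp_pos 1).ne'
  field_simp

/-! ## §1 THE RESPONSE FACES FIRE ON W24's LINEAR PENCIL — S24 `regenPart_locE_le_torus` and `muDeriv_locE_le_torus`, ONCE each -/

open Classical in
/-- **S24 `regenPart_locE_le_torus` FIRES** ((w5) regeneration constant with decay, BY NAME, once): on W24's one-cube datum with the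
table-strength pencil of radius `ϱ := 2` and slope `A⋆∕2` (envelope `A⋆·𝟙[Z = X₀]`, `r₁ = 0`, `R = 2·(64·log 162) + 2`),
`‖E_1({0}) − E_0({0})‖ ≤ (e·9·64·K₀(64,8)²·A⋆·e⁰)∕(2 − 1)`. [folklore] -/
theorem regen_fires_torus :
    ‖locE (TTouch (d := 4) (N := N)) (fun Z : (tsys 4 N).Dom => Z.1) (act N ((Real.exp 1 * K₀ 64 8 * 9 * 64)⁻¹ / 2) 1) (X₀ N).1 -
        locE (TTouch (d := 4) (N := N)) (fun Z : (tsys 4 N).Dom => Z.1) (act N ((Real.exp 1 * K₀ 64 8 * 9 * 64)⁻¹ / 2) 0) (X₀ N).1‖ ≤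
      Real.exp 1 * 9 * 64 * K₀ 64 8 ^ 2 * (Real.exp 1 * K₀ 64 8 * 9 * 64)⁻¹ * Real.exp (-(0 * torusTreeLen (X₀ N).1)) / (2 - 1) :=
  regenPart_locE_le_torus (X₀ N) (m := fun Z : (tsys 4 N).Dom => if Z.1 = {0} then (Real.exp 1 * K₀ 64 8 * 9 * 64)⁻¹ else 0)
    (R := 2 * (64 * Real.log 162) + 2) Astar_pos.le le_rfl hrate_torus_num (hsmall_num le_rfl) (hhol_torus N _ 2 (X₀ N))
    (hm_torus N Astar_pos.le two_pos (X₀ N)) (hL3_torus N Astar_pos.le _ (X₀ N)) one_lt_two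

open Classical in
/-- CLOSED FORM: the regeneration face's bound on the datum is `K₀(64,8)` (`(2 − 1)⁻¹ = 1`). [folklore] -/
theorem regen_fires_torus' :
    ‖locE (TTouch (d := 4) (N := N)) (fun Z : (tsys 4 N).Dom => Z.1) (act N ((Real.exp 1 * K₀ 64 8 * 9 * 64)⁻¹ / 2) 1) (X₀ N).1 -
        locE (TTouch (d := 4) (N := N)) (fun Z : (tsys 4 N).Dom => Z.1) (act N ((Real.exp 1 * K₀ 64 8 * 9 * 64)⁻¹ / 2) 0) (X₀ N).1‖ ≤
      K₀ 64 8 := by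
  have h := regen_fires_torus N
  rwa [envelope_closed, show (2 : ℝ) - 1 = 1 by norm_num, div_one] at h

open Classical in
/-- **S24 `muDeriv_locE_le_torus` FIRES** (LINEAR RESPONSE in the source, BY NAME, once): on W24's datum with slope `A⋆∕μ₁`, for
`‖μ‖ ≤ μ₀ < μ₁`, `‖d∕ds E_s({0})|_{s = μ}‖ ≤ 2·(e·9·64·K₀(64,8)²·A⋆·e⁰)∕(μ₁ − μ₀)`. [folklore] -/
theorem muDeriv_fires_torus {μ₁ μ₀ : ℝ} {μ : ℂ} (h0 : 0 < μ₀) (h01 : μ₀ < μ₁) (hμ : ‖μ‖ ≤ μ₀) :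
    ‖deriv (fun s => locE (TTouch (d := 4) (N := N)) (fun Z : (tsys 4 N).Dom => Z.1)
        (act N ((Real.exp 1 * K₀ 64 8 * 9 * 64)⁻¹ / μ₁) s) (X₀ N).1) μ‖ ≤
      2 * (Real.exp 1 * 9 * 64 * K₀ 64 8 ^ 2 * (Real.exp 1 * K₀ 64 8 * 9 * 64)⁻¹ * Real.exp (-(0 * torusTreeLen (X₀ N).1))) /
        (μ₁ - μ₀) :=
  muDeriv_locE_le_torus (X₀ N) (m := fun Z : (tsys 4 N).Dom => if Z.1 = {0} then (Real.exp 1 * K₀ 64 8 * 9 * 64)⁻¹ else 0)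
    (R := 2 * (64 * Real.log 162) + 2) Astar_pos.le le_rfl hrate_torus_num (hsmall_num le_rfl) (hhol_torus N _ μ₁ (X₀ N))
    (hm_torus N Astar_pos.le (h0.trans h01) (X₀ N)) (hL3_torus N Astar_pos.le _ (X₀ N)) h01 hμ

open Classical in
/-- CLOSED FORM: `‖d∕ds E_s({0})|_{s = μ}‖ ≤ 2·K₀(64,8)∕(μ₁ − μ₀)`. [folklore] -/
theorem muDeriv_fires_torus' {μ₁ μ₀ : ℝ} {μ : ℂ} (h0 : 0 < μ₀) (h01 : μ₀ < μ₁) (hμ : ‖μ‖ ≤ μ₀) :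
    ‖deriv (fun s => locE (TTouch (d := 4) (N := N)) (fun Z : (tsys 4 N).Dom => Z.1)
        (act N ((Real.exp 1 * K₀ 64 8 * 9 * 64)⁻¹ / μ₁) s) (X₀ N).1) μ‖ ≤ 2 * K₀ 64 8 / (μ₁ - μ₀) := by
  have h := muDeriv_fires_torus N h0 h01 hμ
  rwa [envelope_closed] at h

/-! ## §2 THE SOURCE DERIVATIVE OF THE TOY OUTPUT IN CLOSED FORM: `d∕ds E_{act c s}({0}) = c∕(1 + s·c)` -/

open Classical in
/-- **HOLOMORPHY OF THE TOY OUTPUT ON ANY DISC WHERE THE CLAUSE HOLDS** (S24 `differentiableOn_locE_torus` BY NAME with W24's sockets):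
for a slope `c` and radius `ρ` with `0 < ρ` and `ρ·c ≤ A⋆`, `s ↦ E_{act c s}({0})` is complex differentiable on `‖s‖ < ρ`. [folklore] -/
theorem differentiableOn_locE_cube {c ρ : ℝ} (hc : 0 ≤ c) (hρ : 0 < ρ) (hρc : ρ * c ≤ (Real.exp 1 * K₀ 64 8 * 9 * 64)⁻¹) :
    DifferentiableOn ℂ (fun s => locE (TTouch (d := 4) (N := N)) (fun Z : (tsys 4 N).Dom => Z.1) (act N c s) (X₀ N).1)
      (ball (0 : ℂ) ρ) := by
  have hA : 0 ≤ ρ * c := mul_nonneg hρ.le hc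
  have hcr : c = ρ * c / ρ := by field_simp
  rw [hcr]
  exact differentiableOn_locE_torus (X₀ N) (m := fun Z : (tsys 4 N).Dom => if Z.1 = {0} then ρ * c else 0)
    (R := 2 * (64 * Real.log 162) + 2) hA le_rfl hrate_torus_num (hsmall_num hρc) (hhol_torus N _ ρ (X₀ N))
    (hm_torus N hA hρ (X₀ N)) (hL3_torus N hA _ (X₀ N))

open Classical in
/-- On the disc `‖s‖ < ρ` with `ρ·c ≤ A⋆` the pencil's value on the cube has norm `< 1` (`A⋆ ≤ 1`, W24 `dressedConst_le_one`), so W24's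
identity `exp E_{act c s}({0}) = 1 + s·c` (`exp_locE_cube`) is available there. [folklore] -/
theorem norm_act_X₀_lt_one {c ρ : ℝ} (hc : 0 < c) (hρc : ρ * c ≤ (Real.exp 1 * K₀ 64 8 * 9 * 64)⁻¹) {s : ℂ}
    (hs : s ∈ ball (0 : ℂ) ρ) : ‖act N c s (X₀ N)‖ < 1 := by
  rw [act_X₀, norm_mul, Complex.norm_real, Real.norm_eq_abs, abs_of_pos hc]
  calc ‖s‖ * c < ρ * c := mul_lt_mul_of_pos_right (mem_ball_zero_iff.1 hs) hc
    _ ≤ _ := hρc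
    _ ≤ 1 := dressedConst_le_one

open Classical in
/-- **THE SOURCE DERIVATIVE IN CLOSED FORM** (kernel): for `0 < c`, `0 < ρ`, `ρ·c ≤ A⋆` and `‖μ‖ < ρ`,
`HasDerivAt (s ↦ E_{act c s}({0})) (c ∕ (1 + μ·c)) μ` — differentiate W24's identity `exp E_{act c s}({0}) = 1 + s·c` (`exp_locE_cube`,
valid on the disc since `ρ·c ≤ A⋆ ≤ 1`) using the holomorphy face for `DifferentiableAt` and the uniqueness of derivatives. [folklore] -/
theorem hasDerivAt_locE_cube {c ρ : ℝ} (hc : 0 < c) (hρ : 0 < ρ) (hρc : ρ * c ≤ (Real.exp 1 * K₀ 64 8 * 9 * 64)⁻¹)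
    {μ : ℂ} (hμ : ‖μ‖ < ρ) :
    HasDerivAt (fun s => locE (TTouch (d := 4) (N := N)) (fun Z : (tsys 4 N).Dom => Z.1) (act N c s) (X₀ N).1)
      ((c : ℂ) / (1 + μ * c)) μ := by
  set E : ℂ → ℂ := fun s => locE (TTouch (d := 4) (N := N)) (fun Z : (tsys 4 N).Dom => Z.1) (act N c s) (X₀ N).1 with hE_def
  have hμb : μ ∈ ball (0 : ℂ) ρ := mem_ball_zero_iff.2 hμ
  have hball : ball (0 : ℂ) ρ ∈ nhds μ := isOpen_ball.mem_nhds hμb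
  have hE : HasDerivAt E (deriv E μ) μ :=
    ((differentiableOn_locE_cube N hc.le hρ hρc).differentiableAt hball).hasDerivAt
  -- on the disc, `exp ∘ E = 1 + s·c`
  have hexp : ∀ s ∈ ball (0 : ℂ) ρ, Complex.exp (E s) = 1 + s * c := fun s hs => by
    have h := exp_locE_cube N (w := act N c s) (norm_act_X₀_lt_one N hc hρc hs)
    rw [act_X₀] at h
    exact h
  have h1 : HasDerivAt (fun s => Complex.exp (E s)) (Complex.exp (E μ) * deriv E μ) μ := hE.cexp
  have h2 : HasDerivAt (fun s : ℂ => 1 + s * c) (Complex.exp (E μ) * deriv E μ) μ :=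
    h1.congr_of_eventuallyEq (Filter.eventually_of_mem hball fun s hs => (hexp s hs).symm)
  have h3 : HasDerivAt (fun s : ℂ => 1 + s * c) (c : ℂ) μ := by
    simpa using ((hasDerivAt_id μ).mul_const (c : ℂ)).const_add 1
  have h4 : Complex.exp (E μ) * deriv E μ = c := h2.unique h3
  have hne : (1 : ℂ) + μ * c ≠ 0 := by rw [← hexp μ hμb]; exact Complex.exp_ne_zero _
  have h5 : deriv E μ = (c : ℂ) / (1 + μ * c) := by
    rw [eq_div_iff hne, mul_comm, ← hexp μ hμb]; exact h4
  exact h5 ▸ hE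

open Classical in
/-- `deriv` form of the closed formula. [folklore] -/
theorem deriv_locE_cube {c ρ : ℝ} (hc : 0 < c) (hρ : 0 < ρ) (hρc : ρ * c ≤ (Real.exp 1 * K₀ 64 8 * 9 * 64)⁻¹)
    {μ : ℂ} (hμ : ‖μ‖ < ρ) :
    deriv (fun s => locE (TTouch (d := 4) (N := N)) (fun Z : (tsys 4 N).Dom => Z.1) (act N c s) (X₀ N).1) μ =
      (c : ℂ) / (1 + μ * c) :=
  (hasDerivAt_locE_cube N hc hρ hρc hμ).deriv

open Classical in
/-- **GENUINE — THE LINEAR RESPONSE IS NOT ZERO** on the datum: `d∕ds E_{act c s}({0})|_{s=μ} ≠ 0` for `0 < c`. [folklore] -/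
theorem deriv_locE_cube_ne_zero {c ρ : ℝ} (hc : 0 < c) (hρ : 0 < ρ) (hρc : ρ * c ≤ (Real.exp 1 * K₀ 64 8 * 9 * 64)⁻¹)
    {μ : ℂ} (hμ : ‖μ‖ < ρ) :
    deriv (fun s => locE (TTouch (d := 4) (N := N)) (fun Z : (tsys 4 N).Dom => Z.1) (act N c s) (X₀ N).1) μ ≠ 0 := by
  rw [deriv_locE_cube N hc hρ hρc hμ]
  have hne : (1 : ℂ) + μ * c ≠ 0 := by
    intro h
    have h1 : ‖μ * (c : ℂ)‖ = 1 := by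
      rw [show μ * (c : ℂ) = -1 by linear_combination h, norm_neg, norm_one]
    rw [norm_mul, Complex.norm_real, Real.norm_eq_abs, abs_of_pos hc] at h1
    have : ‖μ‖ * c < 1 :=
      calc ‖μ‖ * c < ρ * c := mul_lt_mul_of_pos_right hμ hc
        _ ≤ _ := hρc
        _ ≤ 1 := dressedConst_le_one
    exact this.ne h1
  exact div_ne_zero (by exact_mod_cast hc.ne') hne

open Classical in
/-- **THE FACE'S ROOM ON THE DATUM, DISPLAYED** (kernel): at the face's own slope `c = A⋆∕μ₁` and `‖μ‖ ≤ μ₀ < μ₁` the EXACT response has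
`‖d∕ds E_s({0})|_{s=μ}‖ ≤ A⋆∕(μ₁ − μ₀)` (from `c∕‖1 + μc‖ ≤ c∕(1 − μ₀c)` and `A⋆ ≤ 1`), against the face's `2·K₀(64,8)∕(μ₁ − μ₀)`
(`muDeriv_fires_torus'`): the (w6)-allowance face is met on the carrier with room `A⋆ : 2K₀(64,8)`. [folklore] -/
theorem norm_deriv_locE_cube_le {μ₁ μ₀ : ℝ} {μ : ℂ} (h0 : 0 < μ₀) (h01 : μ₀ < μ₁) (hμ : ‖μ‖ ≤ μ₀) :
    ‖deriv (fun s => locE (TTouch (d := 4) (N := N)) (fun Z : (tsys 4 N).Dom => Z.1)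
        (act N ((Real.exp 1 * K₀ 64 8 * 9 * 64)⁻¹ / μ₁) s) (X₀ N).1) μ‖ ≤
      (Real.exp 1 * K₀ 64 8 * 9 * 64)⁻¹ / (μ₁ - μ₀) := by
  have hμ₁ : 0 < μ₁ := h0.trans h01
  have hA := Astar_pos
  set A : ℝ := (Real.exp 1 * K₀ 64 8 * 9 * 64)⁻¹ with hA_def
  have hc : 0 < A / μ₁ := div_pos hA hμ₁
  have hρc : μ₁ * (A / μ₁) ≤ A := by rw [mul_div_cancel₀ _ hμ₁.ne']
  rw [deriv_locE_cube N hc hμ₁ hρc (lt_of_le_of_lt hμ h01), norm_div, Complex.norm_real, Real.norm_eq_abs, abs_of_pos hc]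
  -- `1 − μ₀·(A∕μ₁) ≤ ‖1 + μ·(A∕μ₁)‖`
  have hA1 : A ≤ 1 := dressedConst_le_one
  have hlow : 1 - μ₀ * (A / μ₁) ≤ ‖(1 : ℂ) + μ * (A / μ₁ : ℝ)‖ := by
    have h := norm_sub_norm_le (1 : ℂ) (-(μ * (A / μ₁ : ℝ)))
    rw [norm_one, norm_neg, sub_neg_eq_add, norm_mul, Complex.norm_real, Real.norm_eq_abs, abs_of_pos hc] at h
    refine le_trans ?_ h
    gcongr
  have hpos : 0 < 1 - μ₀ * (A / μ₁) := by
    have : μ₀ * (A / μ₁) < 1 :=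
      calc μ₀ * (A / μ₁) < μ₁ * (A / μ₁) := mul_lt_mul_of_pos_right h01 hc
        _ = A := mul_div_cancel₀ _ hμ₁.ne'
        _ ≤ 1 := hA1
    linarith
  calc A / μ₁ / ‖(1 : ℂ) + μ * (A / μ₁ : ℝ)‖ ≤ A / μ₁ / (1 - μ₀ * (A / μ₁)) :=
        div_le_div_of_nonneg_left hc.le hpos hlow
    _ = A / (μ₁ - μ₀ * A) := by field_simp
    _ ≤ A / (μ₁ - μ₀) := by
        apply div_le_div_of_nonneg_left hA.le (by linarith)
        nlinarith
    _ = _ := by rw [hA_def]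

/-! ## §3 THE JOINT-ANALYTICITY FACES FIRE — S25's three torus ENDs on the BACKGROUND-MODULATED pencil `p ↦ act c (p.1·p.2)` -/

/-- A joint parameter `(s, u) ∈ ball 0 μ₁ ×ˢ ball 0 1` has effective source `s·u` in the source disc: `‖s·u‖ < μ₁` (and `0 < μ₁`).
[folklore] -/
theorem mul_mem_ball_of_mem_prod {μ₁ : ℝ} {p : ℂ × ℂ} (hp : p ∈ ball (0 : ℂ) μ₁ ×ˢ ball (0 : ℂ) 1) :
    0 < μ₁ ∧ p.1 * p.2 ∈ ball (0 : ℂ) μ₁ := by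
  rw [Set.mem_prod, mem_ball_zero_iff, mem_ball_zero_iff] at hp
  refine ⟨(norm_nonneg _).trans_lt hp.1, mem_ball_zero_iff.2 ?_⟩
  rw [norm_mul]
  nlinarith [norm_nonneg p.1, norm_nonneg p.2, hp.1, hp.2]

/-- **Socket (E1) in the JOINT parameter** on the carrier: every activity of the background-modulated pencil is complex (Fréchet)
differentiable on `ball 0 μ₁ ×ˢ ball 0 1 ⊂ ℂ × ℂ` (bilinear `(s,u) ↦ s·u` times a constant, or zero). [folklore] -/
theorem hhol_joint_torus (c μ₁ : ℝ) (X : (tsys 4 N).Dom) : ∀ Z : (tsys 4 N).Dom, Z.1 ⊆ X.1 →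
    DifferentiableOn ℂ (fun p : ℂ × ℂ => act N c (p.1 * p.2) Z) (ball (0 : ℂ) μ₁ ×ˢ ball (0 : ℂ) 1) := by
  intro Z _; unfold act; split_ifs
  exacts [(by fun_prop : Differentiable ℂ fun p : ℂ × ℂ => p.1 * p.2 * (c : ℂ)).differentiableOn, differentiableOn_const _]

open Classical in
/-- **Socket (E2) in the JOINT parameter** on the carrier: with slope `A∕μ₁` the modulated pencil is dominated by `A·𝟙[Z = X₀]` on the
product domain (W24 `hm_torus` at the effective source `s·u`). [folklore] -/
theorem hm_joint_torus {A μ₁ : ℝ} (hA : 0 ≤ A) (X : (tsys 4 N).Dom) :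
    ∀ p ∈ ball (0 : ℂ) μ₁ ×ˢ ball (0 : ℂ) 1, ∀ Z : (tsys 4 N).Dom, Z.1 ⊆ X.1 →
      ‖act N (A / μ₁) (p.1 * p.2) Z‖ ≤ (fun Z : (tsys 4 N).Dom => if Z.1 = {0} then A else 0) Z :=
  fun _ hp Z hZ => (mul_mem_ball_of_mem_prod hp).elim fun hμ₁ hs => hm_torus N hA hμ₁ X _ hs Z hZ

open Classical in
/-- **S25 `differentiableOn_locE_source_background_torus` FIRES** (JOINT HOLOMORPHY in (source, background), BY NAME, once; background
space `B := ℂ`, `W := ball 0 1`): the output `(s,u) ↦ E_{act (A⋆∕μ₁) (s·u)}({0})` of the modulated pencil on the carrier is jointly complex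
differentiable on `ball 0 μ₁ ×ˢ ball 0 1`. [folklore] -/
theorem jointFace_fires_torus {μ₁ : ℝ} :
    DifferentiableOn ℂ (fun p : ℂ × ℂ => locE (TTouch (d := 4) (N := N)) (fun Z : (tsys 4 N).Dom => Z.1)
        (act N ((Real.exp 1 * K₀ 64 8 * 9 * 64)⁻¹ / μ₁) (p.1 * p.2)) (X₀ N).1) (ball (0 : ℂ) μ₁ ×ˢ ball (0 : ℂ) 1) :=
  differentiableOn_locE_source_background_torus (X₀ N) (B := ℂ)
    (m := fun Z : (tsys 4 N).Dom => if Z.1 = {0} then (Real.exp 1 * K₀ 64 8 * 9 * 64)⁻¹ else 0)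
    (act := fun p Z => act N ((Real.exp 1 * K₀ 64 8 * 9 * 64)⁻¹ / μ₁) (p.1 * p.2) Z) (R := 2 * (64 * Real.log 162) + 2)
    (W := ball (0 : ℂ) 1) isOpen_ball Astar_pos.le le_rfl hrate_torus_num (hsmall_num le_rfl) (hhol_joint_torus N _ μ₁ (X₀ N))
    (hm_joint_torus N Astar_pos.le (X₀ N)) (hL3_torus N Astar_pos.le _ (X₀ N))

open Classical in
/-- **S25 `differentiableOn_locE_param_torus` FIRES with a GENUINELY two-dimensional parameter** (`P := ℂ × ℂ`,
`U := ball 0 μ₁ ×ˢ ball 0 1`, open by `isOpen_ball.prod isOpen_ball`): the same conclusion through the general-parameter END. [folklore] -/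
theorem paramFace_fires_torus {μ₁ : ℝ} :
    DifferentiableOn ℂ (fun p : ℂ × ℂ => locE (TTouch (d := 4) (N := N)) (fun Z : (tsys 4 N).Dom => Z.1)
        (act N ((Real.exp 1 * K₀ 64 8 * 9 * 64)⁻¹ / μ₁) (p.1 * p.2)) (X₀ N).1) (ball (0 : ℂ) μ₁ ×ˢ ball (0 : ℂ) 1) :=
  differentiableOn_locE_param_torus (X₀ N) (P := ℂ × ℂ)
    (m := fun Z : (tsys 4 N).Dom => if Z.1 = {0} then (Real.exp 1 * K₀ 64 8 * 9 * 64)⁻¹ else 0)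
    (act := fun p Z => act N ((Real.exp 1 * K₀ 64 8 * 9 * 64)⁻¹ / μ₁) (p.1 * p.2) Z) (R := 2 * (64 * Real.log 162) + 2)
    (U := ball (0 : ℂ) μ₁ ×ˢ ball (0 : ℂ) 1) (isOpen_ball.prod isOpen_ball) Astar_pos.le le_rfl hrate_torus_num (hsmall_num le_rfl)
    (hhol_joint_torus N _ μ₁ (X₀ N)) (hm_joint_torus N Astar_pos.le (X₀ N)) (hL3_torus N Astar_pos.le _ (X₀ N))

open Classical in
/-- **S25 `analytic_and_bounded_locE_param_torus` FIRES — THE (1.18)-TYPE PAIR on the carrier**: joint holomorphy on the product domain AND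
the (2.41) envelope `e·9·64·K₀(64,8)²·A⋆·e⁰` at every joint parameter there. [folklore] -/
theorem pairFace_fires_torus {μ₁ : ℝ} :
    DifferentiableOn ℂ (fun p : ℂ × ℂ => locE (TTouch (d := 4) (N := N)) (fun Z : (tsys 4 N).Dom => Z.1)
        (act N ((Real.exp 1 * K₀ 64 8 * 9 * 64)⁻¹ / μ₁) (p.1 * p.2)) (X₀ N).1) (ball (0 : ℂ) μ₁ ×ˢ ball (0 : ℂ) 1) ∧
      ∀ p ∈ ball (0 : ℂ) μ₁ ×ˢ ball (0 : ℂ) 1,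
        ‖locE (TTouch (d := 4) (N := N)) (fun Z : (tsys 4 N).Dom => Z.1)
            (act N ((Real.exp 1 * K₀ 64 8 * 9 * 64)⁻¹ / μ₁) (p.1 * p.2)) (X₀ N).1‖ ≤
          Real.exp 1 * 9 * 64 * K₀ 64 8 ^ 2 * (Real.exp 1 * K₀ 64 8 * 9 * 64)⁻¹ * Real.exp (-(0 * torusTreeLen (X₀ N).1)) :=
  analytic_and_bounded_locE_param_torus (X₀ N) (P := ℂ × ℂ)
    (m := fun Z : (tsys 4 N).Dom => if Z.1 = {0} then (Real.exp 1 * K₀ 64 8 * 9 * 64)⁻¹ else 0)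
    (act := fun p Z => act N ((Real.exp 1 * K₀ 64 8 * 9 * 64)⁻¹ / μ₁) (p.1 * p.2) Z) (R := 2 * (64 * Real.log 162) + 2)
    (U := ball (0 : ℂ) μ₁ ×ˢ ball (0 : ℂ) 1) (isOpen_ball.prod isOpen_ball) Astar_pos.le le_rfl hrate_torus_num (hsmall_num le_rfl)
    (hhol_joint_torus N _ μ₁ (X₀ N)) (hm_joint_torus N Astar_pos.le (X₀ N)) (hL3_torus N Astar_pos.le _ (X₀ N))

open Classical in
/-- The bound half in CLOSED FORM: `‖E_{(s,u)}({0})‖ ≤ K₀(64,8)` at every joint parameter of the product domain. [folklore] -/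
theorem norm_locE_joint_torus_le {μ₁ : ℝ} {p : ℂ × ℂ} (hp : p ∈ ball (0 : ℂ) μ₁ ×ˢ ball (0 : ℂ) 1) :
    ‖locE (TTouch (d := 4) (N := N)) (fun Z : (tsys 4 N).Dom => Z.1)
        (act N ((Real.exp 1 * K₀ 64 8 * 9 * 64)⁻¹ / μ₁) (p.1 * p.2)) (X₀ N).1‖ ≤ K₀ 64 8 := by
  have h := (pairFace_fires_torus N (μ₁ := μ₁)).2 p hp
  rwa [envelope_closed] at h

/-! ### GENUINE: the jointly holomorphic output is constant in NEITHER the source NOR the background -/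

open Classical in
/-- **THE TOY OUTPUT SEPARATES SOURCES** (kernel; W24 `exp_locE_cube`): for `0 < c` and two sources `s`, `s'` with `‖s‖·c < 1`,
`‖s'‖·c < 1`, equal outputs `E_{act c s}({0}) = E_{act c s'}({0})` force `s = s'` (exponentials `1 + s·c = 1 + s'·c`). [folklore] -/
theorem eq_of_locE_cube_eq {c : ℝ} (hc : 0 < c) {s s' : ℂ} (hs : ‖s‖ * c < 1) (hs' : ‖s'‖ * c < 1)
    (h : locE (TTouch (d := 4) (N := N)) (fun Z : (tsys 4 N).Dom => Z.1) (act N c s) (X₀ N).1 =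
      locE (TTouch (d := 4) (N := N)) (fun Z : (tsys 4 N).Dom => Z.1) (act N c s') (X₀ N).1) : s = s' := by
  have hn : ∀ {t : ℂ}, ‖t‖ * c < 1 → ‖act N c t (X₀ N)‖ < 1 := fun ht => by
    rwa [act_X₀, norm_mul, Complex.norm_real, Real.norm_eq_abs, abs_of_pos hc]
  have h1 := exp_locE_cube N (hn hs)
  have h2 := exp_locE_cube N (hn hs')
  rw [X₀_val] at h
  rw [h, h2, act_X₀, act_X₀] at h1
  have hcne : (c : ℂ) ≠ 0 := by exact_mod_cast hc.ne'
  exact (mul_left_injective₀ hcne (by linear_combination h1)).symm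

open Classical in
/-- **GENUINE — THE JOINT OUTPUT MOVES WITH THE BACKGROUND**: at a source `μ ≠ 0` of the disc, two backgrounds `u ≠ u'` of the unit ball
give different outputs. [folklore] -/
theorem jointOutput_moves_with_background_torus {μ₁ : ℝ} {μ u u' : ℂ} (hμ : μ ∈ ball (0 : ℂ) μ₁) (hu : u ∈ ball (0 : ℂ) 1)
    (hu' : u' ∈ ball (0 : ℂ) 1) (hμ0 : μ ≠ 0) (huu : u ≠ u') :
    locE (TTouch (d := 4) (N := N)) (fun Z : (tsys 4 N).Dom => Z.1)
        (act N ((Real.exp 1 * K₀ 64 8 * 9 * 64)⁻¹ / μ₁) (μ * u)) (X₀ N).1 ≠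
      locE (TTouch (d := 4) (N := N)) (fun Z : (tsys 4 N).Dom => Z.1)
        (act N ((Real.exp 1 * K₀ 64 8 * 9 * 64)⁻¹ / μ₁) (μ * u')) (X₀ N).1 := by
  have hμ₁ : 0 < μ₁ := (norm_nonneg _).trans_lt (mem_ball_zero_iff.1 hμ)
  have hc : 0 < (Real.exp 1 * K₀ 64 8 * 9 * 64)⁻¹ / μ₁ := div_pos Astar_pos hμ₁
  have hlt : ∀ {v : ℂ}, v ∈ ball (0 : ℂ) 1 → ‖μ * v‖ * ((Real.exp 1 * K₀ 64 8 * 9 * 64)⁻¹ / μ₁) < 1 := fun {v} hv => by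
    have hs := (mul_mem_ball_of_mem_prod (p := (μ, v)) (Set.mk_mem_prod hμ hv)).2
    calc ‖μ * v‖ * ((Real.exp 1 * K₀ 64 8 * 9 * 64)⁻¹ / μ₁) < μ₁ * ((Real.exp 1 * K₀ 64 8 * 9 * 64)⁻¹ / μ₁) :=
          mul_lt_mul_of_pos_right (mem_ball_zero_iff.1 hs) hc
      _ = (Real.exp 1 * K₀ 64 8 * 9 * 64)⁻¹ := mul_div_cancel₀ _ hμ₁.ne'
      _ ≤ 1 := dressedConst_le_one
  intro h
  exact huu (mul_left_cancel₀ hμ0 (eq_of_locE_cube_eq N hc (hlt hu) (hlt hu') h))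

open Classical in
/-- **GENUINE — THE JOINT OUTPUT MOVES WITH THE SOURCE**: at a background `u ≠ 0` of the unit ball, two sources `μ ≠ μ'` of the disc
give different outputs. [folklore] -/
theorem jointOutput_moves_with_source_torus {μ₁ : ℝ} {μ μ' u : ℂ} (hμ : μ ∈ ball (0 : ℂ) μ₁) (hμ' : μ' ∈ ball (0 : ℂ) μ₁)
    (hu : u ∈ ball (0 : ℂ) 1) (hu0 : u ≠ 0) (hμμ : μ ≠ μ') :
    locE (TTouch (d := 4) (N := N)) (fun Z : (tsys 4 N).Dom => Z.1)
        (act N ((Real.exp 1 * K₀ 64 8 * 9 * 64)⁻¹ / μ₁) (μ * u)) (X₀ N).1 ≠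
      locE (TTouch (d := 4) (N := N)) (fun Z : (tsys 4 N).Dom => Z.1)
        (act N ((Real.exp 1 * K₀ 64 8 * 9 * 64)⁻¹ / μ₁) (μ' * u)) (X₀ N).1 := by
  have hμ₁ : 0 < μ₁ := (norm_nonneg _).trans_lt (mem_ball_zero_iff.1 hμ)
  have hc : 0 < (Real.exp 1 * K₀ 64 8 * 9 * 64)⁻¹ / μ₁ := div_pos Astar_pos hμ₁
  have hlt : ∀ {v : ℂ}, v ∈ ball (0 : ℂ) μ₁ → ‖v * u‖ * ((Real.exp 1 * K₀ 64 8 * 9 * 64)⁻¹ / μ₁) < 1 := fun {v} hv => by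
    have hs := (mul_mem_ball_of_mem_prod (p := (v, u)) (Set.mk_mem_prod hv hu)).2
    calc ‖v * u‖ * ((Real.exp 1 * K₀ 64 8 * 9 * 64)⁻¹ / μ₁) < μ₁ * ((Real.exp 1 * K₀ 64 8 * 9 * 64)⁻¹ / μ₁) :=
          mul_lt_mul_of_pos_right (mem_ball_zero_iff.1 hs) hc
      _ = (Real.exp 1 * K₀ 64 8 * 9 * 64)⁻¹ := mul_div_cancel₀ _ hμ₁.ne'
      _ ≤ 1 := dressedConst_le_one
  intro h
  exact hμμ (mul_right_cancel₀ hu0 (eq_of_locE_cube_eq N hc (hlt hμ) (hlt hμ') h))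

end Summit.QuantumFields.BalabanUV.T4Continuum.NE1p.DressedResponseTorusWitness

end
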